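import Summits.ValiantsHypothesis.ValiantsHypothesis.Theorems.KPlusLogSqLawTropicalGradedWalkSigns

/-!
# Route «KPlusLogSqLaw» — GRW-lite (all-`m` `K = 4` family): term signs around the `u = 1` excursion

HONEST FRAMING.  Helper file of the chain `--supports` the crux `Summit.ValiantsHypothesis.ValiantsHypothesis.Theses.KPlusLogSqLaw.TropicalB`
(item `stmt-ValiantsHypothesis-19771`, route `KPlusLogSqLaw`; cell `pub-symmetroid`, seat val-sym-trop-p3 g15), on top of `…GradedWalkSigns.lean`.
Census-side (lower bound) construction for `TropRootLawAt (n+1) 4`; nothing here bears on `TropicalB` in its window, `WeakLifting`,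
`MatrixDescartes` or `VP ≠ VNP`.

CONTENT.  The three transitions of the GRW-lite chain through the `u = 1` excursion pair of a phase `2 ≤ w ≤ n`:
`D(w,0,0) → D(w,1,0)` (column `0` switches from class `1` to class `2`: `termSign_D_zero_one`), `D(w,1,0) → X(w,1,1)` (rows of the
columns `0`, `1` exchanged — column `0` carries the class-`2` flip: `termSign_D_X_one`), and `X(w,1,1) → D(w,2,0)` (`w ≥ 3`) resp.
`X(2,1,1) → T(2,2,0)` (`termSign_X_one_next`, `termSign_X_D_one`, `termSign_X_T_one`); each product of consecutive term signs is `< 0`.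
-/

set_option linter.dupNamespace false
set_option autoImplicit false
-- the `Fin.val_mk` clean-up before `omega` is uniform; where projection reduction already fired it is unused
set_option linter.unusedSimpArgs false

namespace Summit.ValiantsHypothesis.ValiantsHypothesis.Theorems.LacunarySymmetroidMatrixDescartes.TropicalCensus

namespace GradedWalk

open Summit.ValiantsHypothesis.ValiantsHypothesis.Theorems.MatrixDescartes.Negative

variable (n : ℕ)

/-- `D(w,0,0) → D(w,1,0)` (`2 ≤ w ≤ n`): the column `0` switches from class `1` to class `2`. -/
theorem termSign_D_zero_one (w : ℕ) (hw2 : 2 ≤ w) (hwn : w ≤ n) :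
    termSign (ee n) (cterm n w 0 0) * termSign (ee n) (cterm n w 1 0) < 0 := by
  unfold cterm
  rw [perm_D n (show 0 ≠ w by omega), perm_D n (show 1 ≠ w by omega)]
  refine termSign_D_zero_step n w (by omega) hwn (lam n w 1 0) ?_ ?_ ?_
  · intro b hb; rw [lam_D n (show 1 < w by omega), if_pos hb]
  · intro b hb; rw [lam_D n (show 1 < w by omega), if_neg (by omega), if_pos (by omega)]
  · intro b hb hb0
    rw [lam_D n (show 1 < w by omega), if_neg (by omega), if_neg (by omega)]
    exact Or.inl rfl

/-- the sign bookkeeping of the two exchanged columns `0`, `1` of the `u = 1` excursion against a plain-rotation state whose classes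
there are `(2, l₁)` with `l₁ ∈ {1, 2}` (`D(w,1,0)`: `l₁ = 1`; `D(w,2,0)` and `T(2,2,0)`: `l₁ = 2`). -/
theorem exchange_columns_one (w : ℕ) (hw2 : 2 ≤ w) (hwn : w ≤ n) (μ : Fin (n + 1) → Fin 4)
    (hμ0 : μ ⟨0, by omega⟩ = 2) (hμ1 : μ ⟨1, by omega⟩ = 1 ∨ μ ⟨1, by omega⟩ = 2) :
    (ee n (rot n w ⟨0, by omega⟩) ⟨0, by omega⟩ (μ ⟨0, by omega⟩) *
        ee n (perm n w 1 1 ⟨0, by omega⟩) ⟨0, by omega⟩ (lam n w 1 1 ⟨0, by omega⟩)) *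
      (ee n (rot n w ⟨1, by omega⟩) ⟨1, by omega⟩ (μ ⟨1, by omega⟩) *
        ee n (perm n w 1 1 ⟨1, by omega⟩) ⟨1, by omega⟩ (lam n w 1 1 ⟨1, by omega⟩)) = 1 := by
  have hw1 : w ≤ n + 1 := by omega
  have huw : 1 < w := by omega
  have hr0 : ((rot n w ⟨0, by omega⟩ : Fin (n + 1)) : ℕ) = n + 1 - w := by
    rw [rot_val_blk n hw1 _ (by simp only [Fin.val_mk]; omega)]; simp only [Fin.val_mk]; omega
  have hr1 : ((rot n w ⟨1, by omega⟩ : Fin (n + 1)) : ℕ) = n + 1 - w + 1 := by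
    rw [rot_val_blk n hw1 _ (by simp only [Fin.val_mk]; omega)]; simp only [Fin.val_mk]; omega
  have hp0 : ((perm n w 1 1 ⟨0, by omega⟩ : Fin (n + 1)) : ℕ) = n + 1 - w + 1 :=
    sigmaX_um1 n huw hw1 _ (by simp only [Fin.val_mk])
  have hp1 : ((perm n w 1 1 ⟨1, by omega⟩ : Fin (n + 1)) : ℕ) = n + 1 - w := by
    rw [sigmaX_u n huw hwn _ rfl]; omega
  have hl0 : lam n w 1 1 ⟨0, by omega⟩ = 3 := by
    rw [lam_X n huw, if_neg (by simp only [Fin.val_mk]; omega), if_neg (by simp only [Fin.val_mk]; omega),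
      if_pos (by simp only [Fin.val_mk]; omega)]
  have hl1 : lam n w 1 1 ⟨1, by omega⟩ = 1 := by
    rw [lam_X n huw, if_neg (by simp only [Fin.val_mk]; omega), if_neg (by simp only [Fin.val_mk]; omega),
      if_neg (by simp only [Fin.val_mk]; omega)]
  have hlow0 : ((⟨0, by omega⟩ : Fin (n + 1)) : ℕ) < ((rot n w ⟨0, by omega⟩ : Fin (n + 1)) : ℕ) := by
    rw [hr0]; simp only [Fin.val_mk]; omega
  have hlow0' : ((⟨0, by omega⟩ : Fin (n + 1)) : ℕ) < ((perm n w 1 1 ⟨0, by omega⟩ : Fin (n + 1)) : ℕ) := by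
    rw [hp0]; simp only [Fin.val_mk]; omega
  have hlow1 : ((⟨1, by omega⟩ : Fin (n + 1)) : ℕ) < ((rot n w ⟨1, by omega⟩ : Fin (n + 1)) : ℕ) := by
    rw [hr1]; simp only [Fin.val_mk]; omega
  -- the lifted cell `(R₁, 1)` is a lower cell for `w < n` and the diagonal cell for `w = n`; its sign is `(−1)^{R₁}` either way
  have hX1 : ee n (perm n w 1 1 ⟨1, by omega⟩) ⟨1, by omega⟩ 1 = (-1) ^ (n + 1 - w) := by
    rcases Nat.lt_or_ge w n with hwn' | hwn'
    · have hlow1' : ((⟨1, by omega⟩ : Fin (n + 1)) : ℕ) < ((perm n w 1 1 ⟨1, by omega⟩ : Fin (n + 1)) : ℕ) := by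
        rw [hp1]; simp only [Fin.val_mk]; omega
      rw [ee_low_one n hlow1', hp1]; simp only [Fin.val_mk, mul_one]
    · have hdg : ((perm n w 1 1 ⟨1, by omega⟩ : Fin (n + 1)) : ℕ) = ((⟨1, by omega⟩ : Fin (n + 1)) : ℕ) := by
        rw [hp1]; simp only [Fin.val_mk]; omega
      rw [ee_diag_one n hdg]; simp only [Fin.val_mk]; rw [show n + 1 - w = 1 by omega]
  have hsq : ((-1 : ℤ) ^ (n + 1 - w + 1)) * (-1) ^ (n + 1 - w) = -1 := by
    rw [pow_succ, mul_assoc, mul_comm (-1 : ℤ), ← mul_assoc, ← pow_add, ← two_mul, pow_mul]; norm_num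
  rw [hμ0, hl0, hl1, ee_low_two n hlow0, ee_low_three n hlow0', hX1, hr0, hp0]
  simp only [Fin.val_mk, mul_zero, pow_zero, one_mul, if_true]
  rcases hμ1 with h1 | h1
  · rw [h1, ee_low_one n hlow1, hr1]; simp only [Fin.val_mk, mul_one]
    linear_combination (-1 : ℤ) * hsq
  · rw [h1, ee_low_two n hlow1, hr1]; simp only [Fin.val_mk, mul_one, show (1 : ℕ) ≠ 0 from one_ne_zero, if_false]
    linear_combination (-1 : ℤ) * hsq

/-- `D(w,1,0) → X(w,1,1)` (`2 ≤ w ≤ n`): rows of the columns `0`, `1` exchanged. -/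
theorem termSign_D_X_one (w : ℕ) (hw2 : 2 ≤ w) (hwn : w ≤ n) :
    termSign (ee n) (cterm n w 1 0) * termSign (ee n) (cterm n w 1 1) < 0 := by
  have hw1 : w ≤ n + 1 := by omega
  have huw : 1 < w := by omega
  unfold cterm
  rw [perm_D n (Nat.ne_of_lt huw), termSign_mul_termSign, sign_perm_X n huw hw1 le_rfl, mul_neg, ShiftThree.sign_mul_self]
  have hc12 : (⟨0, by omega⟩ : Fin (n + 1)) ≠ ⟨1, by omega⟩ := by
    intro h; have := congrArg Fin.val h; simp only [Fin.val_mk] at this; omega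
  rw [Finset.prod_eq_mul _ _ hc12]
  · have hl0 : lam n w 1 0 ⟨0, by omega⟩ = 2 := by
      rw [lam_D n huw, if_neg (by simp only [Fin.val_mk]; omega), if_pos (by simp only [Fin.val_mk]; omega)]
    have hl1 : lam n w 1 0 ⟨1, by omega⟩ = 1 := by
      rw [lam_D n huw, if_neg (by simp only [Fin.val_mk]; omega), if_neg (by simp only [Fin.val_mk]; omega)]
    have h := exchange_columns_one n w hw2 hwn (lam n w 1 0) hl0 (Or.inl hl1)
    rw [h]; norm_num
  · intro b _ hb
    obtain ⟨hb1, hb2⟩ := hb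
    have hb1' : (b : ℕ) + 1 ≠ 1 := fun h => hb1 (Fin.ext (by simp only [Fin.val_mk]; omega))
    have hb2' : (b : ℕ) ≠ 1 := fun h => hb2 (Fin.ext (by simp only [Fin.val_mk]; omega))
    rw [perm_X_eq_rot n huw hwn le_rfl b hb1' hb2', lam_X_eq_lam_D n huw b hb1' hb2']
    exact ee_mul_self n (present_D n w 1 huw hwn b)
  · intro h; exact absurd (Finset.mem_univ _) h
  · intro h; exact absurd (Finset.mem_univ _) h

/-- `X(w,1,1) → (rot, μ)` where `μ` is class `2` on the columns `0`, `1`, class `1` on the other block columns and class `0` on the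
wrap columns (`D(w,2,0)` for `w ≥ 3`, `T(2,2,0)` for `w = 2`). -/
theorem termSign_X_one_next (w : ℕ) (hw2 : 2 ≤ w) (hwn : w ≤ n) (μ : Fin (n + 1) → Fin 4)
    (hμw : ∀ b : Fin (n + 1), w ≤ (b : ℕ) → μ b = 0) (hμ0 : ∀ b : Fin (n + 1), (b : ℕ) = 0 → μ b = 2)
    (hμ1 : ∀ b : Fin (n + 1), (b : ℕ) = 1 → μ b = 2) (hμr : ∀ b : Fin (n + 1), 2 ≤ (b : ℕ) → (b : ℕ) < w → μ b = 1) :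
    termSign (ee n) (cterm n w 1 1) * termSign (ee n) (rot n w, μ) < 0 := by
  have hw1 : w ≤ n + 1 := by omega
  have huw : 1 < w := by omega
  rw [mul_comm]
  unfold cterm
  rw [termSign_mul_termSign, sign_perm_X n huw hw1 le_rfl, mul_neg, ShiftThree.sign_mul_self]
  have hc12 : (⟨0, by omega⟩ : Fin (n + 1)) ≠ ⟨1, by omega⟩ := by
    intro h; have := congrArg Fin.val h; simp only [Fin.val_mk] at this; omega
  rw [Finset.prod_eq_mul _ _ hc12]
  · have h := exchange_columns_one n w hw2 hwn μ (hμ0 _ rfl) (Or.inr (hμ1 _ rfl))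
    rw [h]; norm_num
  · intro b _ hb
    obtain ⟨hb1, hb2⟩ := hb
    have hb1' : (b : ℕ) + 1 ≠ 1 := fun h => hb1 (Fin.ext (by simp only [Fin.val_mk]; omega))
    have hb2' : (b : ℕ) ≠ 1 := fun h => hb2 (Fin.ext (by simp only [Fin.val_mk]; omega))
    have hlam : lam n w 1 1 b = μ b := by
      rw [lam_X_eq_lam_D n huw b hb1' hb2', lam_D n huw]
      by_cases h3 : w ≤ (b : ℕ)
      · rw [if_pos h3, hμw b h3]
      · rw [if_neg h3, if_neg (by omega), hμr b (by omega) (by omega)]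
    have hμb : μ b = lam n w 1 0 b := by rw [← hlam, lam_X_eq_lam_D n huw b hb1' hb2']
    rw [perm_X_eq_rot n huw hwn le_rfl b hb1' hb2', hlam, hμb]
    exact ee_mul_self n (present_D n w 1 huw hwn b)
  · intro h; exact absurd (Finset.mem_univ _) h
  · intro h; exact absurd (Finset.mem_univ _) h

/-- `X(w,1,1) → D(w,2,0)` (`3 ≤ w ≤ n`). -/
theorem termSign_X_D_one (w : ℕ) (hw3 : 3 ≤ w) (hwn : w ≤ n) :
    termSign (ee n) (cterm n w 1 1) * termSign (ee n) (cterm n w 2 0) < 0 := by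
  have h2w : 2 < w := by omega
  have h := termSign_X_one_next n w (by omega) hwn (lam n w 2 0)
    (fun b hb => by rw [lam_D n h2w, if_pos hb]) (fun b hb => by rw [lam_D n h2w, if_neg (by omega), if_pos (by omega)])
    (fun b hb => by rw [lam_D n h2w, if_neg (by omega), if_pos (by omega)])
    (fun b hb hb' => by rw [lam_D n h2w, if_neg (by omega), if_neg (by omega)])
  unfold cterm at h ⊢
  rw [perm_D n (show 2 ≠ w by omega)]
  exact h

/-- `X(2,1,1) → T(2,2,0)` (`2 ≤ n`). -/
theorem termSign_X_T_one (hn : 2 ≤ n) :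
    termSign (ee n) (cterm n 2 1 1) * termSign (ee n) (cterm n 2 2 0) < 0 := by
  have h := termSign_X_one_next n 2 le_rfl hn (lam n 2 2 0)
    (fun b hb => by rw [lam_T, if_pos hb]) (fun b hb => by rw [lam_T, if_neg (by omega), if_neg (Nat.not_lt_zero _)])
    (fun b hb => by rw [lam_T, if_neg (by omega), if_neg (Nat.not_lt_zero _)])
    (fun b hb hb' => by omega)
  unfold cterm at h ⊢
  rw [perm_T]
  exact h

end GradedWalk

end Summit.ValiantsHypothesis.ValiantsHypothesis.Theorems.LacunarySymmetroidMatrixDescartes.TropicalCensus
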